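import Summits.CriticalPhenomena.CardyFormulaZ2.Theorems.CardyIKTransportIKLinearTransportFarRSWOfInputsPrep

/-!
# Stub `stub_FarRSWOfInputs` (crux stmt-CriticalPhenomena-5076 `CardyIKTransport.IKLinearTransport`, line
# `pinned-diagram-exchange`) — part 2 of 2: conditioning on far events is free

Theorem-only support file (`--supports stmt-CriticalPhenomena-5076`): proves the registered skeleton stub
`stub_FarRSWOfInputs` (skeleton v13) by name and signature. From
(hyp. 1) the UNCONDITIONAL far RSW family `FarRSWBound c S n a b w h univ` at all aspect ratios (black
crossings of the `w × h` box both ways and "no white path from the box reaches sup-distance `≥ n`", each with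
`ν_S`-probability `≥ c_k` whenever `n ≤ w, h ≤ k n`), and
(hyp. 2) DENSITY-FORM RATIO MIXING `RatioMixBound η S n a b w h E L` (`|ν(E ∩ L) − ν(E)ν(L)| ≤ η ν(E)ν(L)` for
`E` determined at sup-distance `≥ n` from the box and `L` determined by the box, `n ≥ N(k, η)`),
the far-CONDITIONED family `FarRSWBound c S n a b w h E` for every measurable `E` follows:

* LARGE SCALES `n ≥ 4(N + 4)` (`farRSW_large`): with `d = ⌊n/4⌋`, hyp. 1 at scale `d` for the same box gives
  the three events unconditional probability `≥ c_in`; each is determined by the box enlarged by `d + 2`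
  (`lrCross_mem_determinedOn`, `farRSW_ring_mem_determinedOn` of part 1) and is measurable
  (`frsw_measurableSet_of_determinedOn_box`), while `E` is determined at sup-distance `≥ n − d − 2 ≥ N` from
  that enlarged box; ratio mixing with `η = 1/2` then gives `ν(E ∩ L) ≥ ½ ν(E) ν(L) ≥ (c_in/2) ν(E)`
  (`frsw_cond_of_ratioMix_half`), and the ring at scale `d` implies the ring at scale `n`.
* SMALL SCALES `n < 4(N + 4)` (`farRSW_small`): finite energy — forcing the `≤ ((k+2) · 4(N+4))²` cells of
  the box enlarged by `n` to be black costs a bounded factor (landed `crsw_condBound_of_cellFlips` with the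
  explicit flips `exists_cellFlip`), and an all-black enlarged box is crossed both ways
  (`frsw_mem_lrCross_of_allBlack`, `frsw_mem_tbCross_of_allBlack`) and meets no white path at all.
-/

noncomputable section

namespace Summit.CriticalPhenomena.CardyFormulaZ2.Theorems.IKLinearTransport.PinnedDiagramExchange

open scoped BigOperators Topology Classical MeasureTheory ProbabilityTheory ENNReal symmDiff
open Filter Set Function MeasureTheory
open Literature.Probability.Percolation Literature.Probability.LatticeModels
open Literature.Probability.RandomPlanarGeometry

/-! ## §1 Two elementary inequalities -/

/-- `FarRSWBound` is monotone in the constant. [folklore] -/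
theorem frsw_farRSWBound_mono {c c' : ℝ} (hcc : c' ≤ c) {S : Set ℤ} {n : ℕ} {a b : ℤ} {w h : ℕ}
    {E : Set Obs} (hF : FarRSWBound c S n a b w h E) : FarRSWBound c' S n a b w h E := fun hdet =>
  ⟨(mul_le_mul_of_nonneg_right hcc measureReal_nonneg).trans (hF hdet).1,
    (mul_le_mul_of_nonneg_right hcc measureReal_nonneg).trans (hF hdet).2.1,
    (mul_le_mul_of_nonneg_right hcc measureReal_nonneg).trans (hF hdet).2.2⟩

/-- RATIO MIXING WITH `η = 1/2` MAKES CONDITIONING FREE: if `ν(L) ≥ c` and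
`|ν(E ∩ L) − ν(E) ν(L)| ≤ ½ ν(E) ν(L)`, then `ν(E ∩ L) ≥ (c/2) ν(E)`. [folklore] -/
theorem frsw_cond_of_ratioMix_half {ν : Measure Obs} {E L : Set Obs} {c : ℝ} (hL : c ≤ ν.real L)
    (hmix : |ν.real (E ∩ L) - ν.real E * ν.real L| ≤ 1 / 2 * (ν.real E * ν.real L)) :
    c / 2 * ν.real E ≤ ν.real (E ∩ L) := by
  have hE : 0 ≤ ν.real E := measureReal_nonneg
  have h1 := (abs_le.1 hmix).1
  have h2 : ν.real E * c ≤ ν.real E * ν.real L := mul_le_mul_of_nonneg_left hL hE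
  nlinarith

/-! ## §2 Small scales: finite energy -/

/-- SMALL SCALES, for an abstract single-cell flip family with factor `K < ∞`: at every scale `n < M` the
far-conditioned family holds with the constant `(2K)^{-((k+2)M)²}` — force the box enlarged by `n` to be
black (`crsw_condBound_of_cellFlips`); it is then crossed both ways and meets no white path. [folklore] -/
theorem farRSW_small_of_cellFlips {K : ℝ≥0∞}
    (hcell : ∀ c : Site 2, ∃ Φ : Ω → Ω, Measurable Φ ∧ μIK.map Φ ≤ K • μIK ∧
      (∀ ω, (Φ ω).2.2.2.2 = ω.2.2.2.2) ∧
      ∀ (S : Set ℤ) (ω : Ω) (v : Site 2), v ∈ blackSet S (Φ ω) ↔ Xor (v ∈ blackSet S ω) (v = c))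
    (hKtop : K ≠ ∞) (k M : ℕ) :
    ∀ (S : Set ℤ) (n : ℕ), 1 ≤ n → n < M → ∀ (a b : ℤ) (w h : ℕ),
      n ≤ w → w ≤ k * n → n ≤ h → h ≤ k * n → ∀ E : Set Obs, MeasurableSet E →
      FarRSWBound (((2 * K) ^ ((k + 2) * M * ((k + 2) * M))).toReal)⁻¹ S n a b w h E := by
  intro S n hn hnM a b w h hnw hwk hnh hhk E hE hdet
  -- the cells of the box enlarged by `n`: off the far region, at most `((k+2)M)²` of them
  set V : Finset (Site 2) := ((Finset.Ico (a - n) (a - n + (w + 2 * n : ℕ))) ×ˢ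
    (Finset.Ico (b - n) (b - n + (h + 2 * n : ℕ)))).image (fun p : ℤ × ℤ => (![p.1, p.2] : Site 2)) with hV
  have hVfar : ∀ c ∈ V, c ∉ farFrom a b w h n := by
    intro c hc hfar
    rw [hV, crsw_mem_boxCells_iff] at hc
    simp only [farFrom, Set.mem_setOf_eq] at hfar
    push_cast at hc hfar
    omega
  have hside : ∀ s : ℕ, s ≤ k * n → s + 2 * n ≤ (k + 2) * M := by
    intro s hs
    have h1 : k * n ≤ k * M := Nat.mul_le_mul_left k hnM.le
    have h2 : (k + 2) * M = k * M + 2 * M := by ring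
    omega
  have hcard : V.card ≤ (k + 2) * M * ((k + 2) * M) :=
    (crsw_card_boxCells_le _ _ _ _).trans (Nat.mul_le_mul (hside w hwk) (hside h hhk))
  -- the cells of the box proper are among them
  have hbox : ∀ x : Obs, (∀ c ∈ V, c ∈ x.1) →
      ∀ v : Site 2, a ≤ v 0 → v 0 < a + w → b ≤ v 1 → v 1 < b + h → v ∈ x.1 := by
    intro x hx v h1 h2 h3 h4
    refine hx v ?_
    rw [hV, crsw_mem_boxCells_iff]
    push_cast
    omega
  have hw1 : 1 ≤ w := hn.trans hnw
  have hh1 : 1 ≤ h := hn.trans hnh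
  refine ⟨crsw_condBound_of_cellFlips hcell hKtop S hE hdet V hVfar
      (fun x hx => frsw_mem_lrCross_of_allBlack a b hw1 hh1 x (hbox x hx)) hcard,
    crsw_condBound_of_cellFlips hcell hKtop S hE hdet V hVfar
      (fun x hx => frsw_mem_tbCross_of_allBlack a b hw1 hh1 x (hbox x hx)) hcard,
    crsw_condBound_of_cellFlips hcell hKtop S hE hdet V hVfar (fun x hx => ?_) hcard⟩
  -- the ring event holds vacuously: no white path touches the all-black box
  intro p hp hpB _ _ _
  obtain ⟨u, hu, huB⟩ := hpB
  exact Bool.false_ne_true ((hp.2.2 u hu).1 (hbox x hx u huB.1 huB.2.1 huB.2.2.1 huB.2.2.2))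

/-- SMALL SCALES for the explicit gauge: for every aspect bound `k` and threshold `M` one constant `c > 0`
serves all scales `1 ≤ n < M`, all patterns `S`, boxes and measurable far events (the single-cell flips
`exists_cellFlip rowFlip_spec colFlip_spec faceFlip_spec`, factor `min(q, 1-q)⁻⁴ < ∞`). [folklore] -/
theorem farRSW_small (k M : ℕ) :
    ∃ c : ℝ, 0 < c ∧ ∀ (S : Set ℤ) (n : ℕ), 1 ≤ n → n < M → ∀ (a b : ℤ) (w h : ℕ),
      n ≤ w → w ≤ k * n → n ≤ h → h ≤ k * n → ∀ E : Set Obs, MeasurableSet E →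
      FarRSWBound c S n a b w h E := by
  have hcell := fun c => exists_cellFlip (R := fun T ω => ((ω.1 ∆ T, ω.2) : Ω))
    (C := fun T ω => ((ω.1, ω.2.1 ∆ T, ω.2.2) : Ω))
    (F := fun g ω => ((ω.1, ω.2.1, ω.2.2.1 ∆ {g}, ω.2.2.2.1 ∆ {g}, ω.2.2.2.2) : Ω))
    rowFlip_spec colFlip_spec faceFlip_spec c
  have hKtop := ENNReal.pow_ne_top (n := 4) faceFlip_factor_ne_top
  obtain ⟨-, -, hpos⟩ := crsw_factor_props hcell hKtop ((k + 2) * M * ((k + 2) * M))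
  exact ⟨_, inv_pos.2 hpos, farRSW_small_of_cellFlips hcell hKtop k M⟩

/-! ## §3 Large scales: ratio mixing with `η = 1/2` -/

/-- LARGE SCALES: from the unconditional family with constant `c_in` at aspect bound `8k + 8` and ratio
mixing with `η = 1/2` at aspect bound `2k + 2` beyond the threshold `N`, the far-conditioned family with
constant `c_in / 2` at all scales `n ≥ 4(N + 4)` and aspect bound `k`. With `d = ⌊n/4⌋`: the unconditional
bounds at scale `d` for the same box; the crossing events and the ring event at scale `d` are determined by
the box enlarged by `d + 2` (`farRSW_ring_mem_determinedOn`) and measurable, `E` is determined at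
sup-distance `≥ n − d − 2 ≥ N` from the enlarged box, so one mixing instance per event applies; finally the
ring at scale `d` implies the ring at scale `n`. [folklore] -/
theorem farRSW_large (k : ℕ) {cin : ℝ}
    (hin : ∀ (S : Set ℤ) (n : ℕ), 1 ≤ n → ∀ (a b : ℤ) (w h : ℕ),
      n ≤ w → w ≤ (8 * k + 8) * n → n ≤ h → h ≤ (8 * k + 8) * n → FarRSWBound cin S n a b w h Set.univ)
    {N : ℕ}
    (hmix : ∀ (S : Set ℤ) (n : ℕ), N ≤ n → ∀ (a b : ℤ) (w h : ℕ),
      w ≤ (2 * k + 2) * n → h ≤ (2 * k + 2) * n → ∀ E L : Set Obs, MeasurableSet E → MeasurableSet L →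
      RatioMixBound (1 / 2) S n a b w h E L) :
    ∀ (S : Set ℤ) (n : ℕ), 4 * (N + 4) ≤ n → ∀ (a b : ℤ) (w h : ℕ),
      n ≤ w → w ≤ k * n → n ≤ h → h ≤ k * n → ∀ E : Set Obs, MeasurableSet E →
      FarRSWBound (cin / 2) S n a b w h E := by
  intro S n hMn a b w h hnw hwk hnh hhk E hE hdet
  haveI : IsProbabilityMeasure (νmix S) := isProbabilityMeasure_nuMix S
  -- `n = n' + d + 2` with `d = ⌊n/4⌋`
  obtain ⟨d, n', rfl, h4d, hd4⟩ :
      ∃ d n' : ℕ, n = n' + d + 2 ∧ 4 * d ≤ n' + d + 2 ∧ n' + d + 2 < 4 * d + 4 :=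
    ⟨n / 4, n - n / 4 - 2, by omega, by omega, by omega⟩
  -- (i) the unconditional inputs at scale `d` for the same box
  have hd1 : 1 ≤ d := by omega
  have haspect : ∀ s : ℕ, s ≤ k * (n' + d + 2) → s ≤ (8 * k + 8) * d := by
    intro s hs
    have h1 : k * (n' + d + 2) ≤ k * (8 * d) := Nat.mul_le_mul_left k (by omega)
    have h2 : (8 * k + 8) * d = k * (8 * d) + 8 * d := by ring
    omega
  have huniv : (Set.univ : Set Obs) ∈ determinedOn (farFrom a b w h d) :=
    fun _ _ _ => ⟨fun _ => Set.mem_univ _, fun _ => Set.mem_univ _⟩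
  obtain ⟨hlr, htb, hring⟩ := hin S d hd1 a b w h (by omega) (haspect w hwk) (by omega) (haspect h hhk) huniv
  simp only [Set.univ_inter, probReal_univ, mul_one] at hlr htb hring
  -- (ii) one mixing instance per event, for the box enlarged by `d + 2` at scale `n'`
  have hNn' : N ≤ n' := by omega
  have haspect' : ∀ s : ℕ, s ≤ k * (n' + d + 2) → s + 2 * d + 4 ≤ (2 * k + 2) * n' := by
    intro s hs
    have h1 : k * (n' + d + 2) ≤ k * (2 * n') := Nat.mul_le_mul_left k (by omega)
    have h2 : (2 * k + 2) * n' = k * (2 * n') + 2 * n' := by ring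
    omega
  have hdetE : E ∈ determinedOn (farFrom (a - d - 2) (b - d - 2) (w + 2 * d + 4) (h + 2 * d + 4) n') := by
    refine ltr_determinedOn_mono (fun v hv => ?_) hdet
    simp only [farFrom, Set.mem_setOf_eq] at hv ⊢
    push_cast at hv ⊢
    omega
  have key : ∀ L : Set Obs,
      L ∈ determinedOn {v : Site 2 | a - d - 2 ≤ v 0 ∧ v 0 < a - d - 2 + ((w + 2 * d + 4 : ℕ) : ℤ) ∧
        b - d - 2 ≤ v 1 ∧ v 1 < b - d - 2 + ((h + 2 * d + 4 : ℕ) : ℤ)} →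
      cin ≤ (νmix S).real L → cin / 2 * (νmix S).real (E) ≤ (νmix S).real (E ∩ L) := by
    intro L hdetL hcL
    exact frsw_cond_of_ratioMix_half hcL (hmix S n' hNn' (a - d - 2) (b - d - 2) (w + 2 * d + 4)
      (h + 2 * d + 4) (haspect' w hwk) (haspect' h hhk) E L hE
      (frsw_measurableSet_of_determinedOn_box _ _ _ _ hdetL) hdetE hdetL)
  -- the box proper lies in the enlarged box
  have hsub : {v : Site 2 | a ≤ v 0 ∧ v 0 < a + w ∧ b ≤ v 1 ∧ v 1 < b + h} ⊆
      {v : Site 2 | a - d - 2 ≤ v 0 ∧ v 0 < a - d - 2 + ((w + 2 * d + 4 : ℕ) : ℤ) ∧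
        b - d - 2 ≤ v 1 ∧ v 1 < b - d - 2 + ((h + 2 * d + 4 : ℕ) : ℤ)} := by
    intro v hv
    simp only [Set.mem_setOf_eq] at hv ⊢
    push_cast
    omega
  refine ⟨key _ (ltr_determinedOn_mono hsub (lrCross_mem_determinedOn a b w h)) hlr,
    key _ (ltr_determinedOn_mono hsub (tbCross_mem_determinedOn a b w h)) htb, ?_⟩
  -- (iii) the ring at scale `d` implies the ring at scale `n`
  refine (key _ (farRSW_ring_mem_determinedOn a b w h d) hring).trans
    (measureReal_mono (Set.inter_subset_inter_right E fun x hx p hp hpB v hv hvF => hx p hp hpB v hv ?_))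
  simp only [farFrom, Set.mem_setOf_eq] at hvF ⊢
  push_cast at hvF ⊢
  omega

/-! ## §4 The registered stub -/

/-- **STUB `stub_FarRSWOfInputs` (skeleton v13) · CONDITIONING ON FAR EVENTS IS FREE**: the unconditional
far RSW family at all aspect ratios (hyp. 1) and density-form ratio mixing (hyp. 2) give the far-CONDITIONED
family `FarRSWBound c S n a b w h E` for every measurable `E` — large scales by one mixing instance with
`η = 1/2` on the box enlarged by `⌊n/4⌋ + 2` (`farRSW_large`), small scales by finite energy
(`farRSW_small`); the constant is the minimum of the two. [folklore] -/
theorem stub_FarRSWOfInputs :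
    (∀ k : ℕ, ∃ c : ℝ, 0 < c ∧ ∀ (S : Set ℤ) (n : ℕ), 1 ≤ n → ∀ (a b : ℤ) (w h : ℕ),
        n ≤ w → w ≤ k * n → n ≤ h → h ≤ k * n → FarRSWBound c S n a b w h Set.univ) →
    (∀ (k : ℕ) (η : ℝ), 0 < η → ∃ N : ℕ, ∀ (S : Set ℤ) (n : ℕ), N ≤ n → ∀ (a b : ℤ) (w h : ℕ),
        w ≤ k * n → h ≤ k * n → ∀ E L : Set Obs, MeasurableSet E → MeasurableSet L →
        RatioMixBound η S n a b w h E L) →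
      ∀ k : ℕ, ∃ c : ℝ, 0 < c ∧ ∀ (S : Set ℤ) (n : ℕ), 1 ≤ n → ∀ (a b : ℤ) (w h : ℕ),
        n ≤ w → w ≤ k * n → n ≤ h → h ≤ k * n → ∀ E : Set Obs, MeasurableSet E →
        FarRSWBound c S n a b w h E := by
  intro hin hmix k
  obtain ⟨cin, hcin, hin'⟩ := hin (8 * k + 8)
  obtain ⟨N, hN⟩ := hmix (2 * k + 2) (1 / 2) one_half_pos
  obtain ⟨cfe, hcfe, hsmall⟩ := farRSW_small k (4 * (N + 4))
  refine ⟨min (cin / 2) cfe, lt_min (half_pos hcin) hcfe, fun S n hn a b w h hnw hwk hnh hhk E hE => ?_⟩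
  rcases Nat.lt_or_ge n (4 * (N + 4)) with hlt | hge
  · exact frsw_farRSWBound_mono (min_le_right _ _) (hsmall S n hn hlt a b w h hnw hwk hnh hhk E hE)
  · exact frsw_farRSWBound_mono (min_le_left _ _)
      (farRSW_large k hin' hN S n hge a b w h hnw hwk hnh hhk E hE)

end Summit.CriticalPhenomena.CardyFormulaZ2.Theorems.IKLinearTransport.PinnedDiagramExchange

end
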